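import Literature.MathematicalPhysics.QuantumFieldTheory.Borinsky2020.TropicalApproximation
import HarnessLib

/-!
# Kaneko–Ueda 2010 (Comput. Phys. Commun. 181, 1352) §3: the NORMAL FORM of a polynomial on a dominant simplicial cone — under the monomial chart `t_j = Π_k z_k^{(v_k)_j}` of a cone `C(V) ⊆ Δ_b^P`, `P(t(z)) = z^{(b,v)}·[a_b + Σ_{c≠b} a_c Π_j z_j^{(c−b, v_j)}]` with `(c−b, v_j) ∈ ℤ_{≥0}` — and its consequence for a quotient `P/Π_k F_k^{a_k}` with positive-coefficient denominators: on the closed cube the quotient is `(explicit constant) × (monomial)`-bounded, hence BOUNDED with a STATED bound once the total exponent is non-negative — PROVED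

independent recomputation; certified where stated, statistical where stated; no new-physics claim.

CITATION HEADER (venture `QEDPrecision`, cell `qed-hepp` (HOME `run/shared/lean/pub/qed-hepp/`), literature seat `qed-hepp-lit` gen 7;
VALUE-FREE: statements about ABSTRACT multivariate polynomials under a monomial change of variables — no Feynman graph, no sector table, no
Monte-Carlo value, nothing per word or per Set-V family). Serves the qed-hepp theory seat's `HOME/theory/BOUNDEDNESS.md` §5.8.1 «LEMMA (leaf
normal form)»: «On a dominated leaf (f·J)(t) = t^E·h(t), h = |det|·P̃/Π F̃_k^{a_k}, P̃ := t^{−val(P)}·P(x(t)) a polynomial (val componentwise along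
the v_l), F̃_k := t^{−⟨v,μ_k⟩}·F_k(x(t)) continuous and ≥ coeff(μ_k) > 0 on the CLOSED cube [0,1]^M; so h is continuous and bounded on [0,1]^M» and
README §1's TARGET «B_{w,σ,g} is BOUNDED on the closed cube with a stated bound»: this file PROVES, for any polynomial `P`, any family of
positive-coefficient polynomials `F_k` with chosen support monomials `b_k` (the dominant ones on the cone, in the application), natural powers
`a_k` and any cone matrix `v` of natural numbers, the pointwise inequality behind that sentence, with the constant written out:
`|P(t(z))| / Π_k F_k(t(z))^{a_k} · Π_l z_l^{w_l} ≤ (Σ_c |p_c|) / Π_k (a_{b_k})^{a_k}` on `(0,1]^M` whenever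
`w_l + val_{v_l}(P) ≥ Σ_k a_k (b_k, v_l)` for every `l` (`abs_eval_div_prod_pow_mul_monom_le`). Cell sheet `HOME/lit/SOURCES.md` §7/§12.

Source [KanekoUeda2010]: T. Kaneko, T. Ueda, "A geometric method of sector decomposition", Comput. Phys. Commun. 181 (2010) 1352–1361 =
arXiv:0908.2897 (LaTeX-derived text held in the cell store, `lit read arxiv:0908.2897`, 13 chunks; locators `[KU chunk pN:Lk]`). VERBATIM.
§2 [p4:L120–L178]: "The purpose of the factorization step is factoring out the possible singularities at t_j = 0 from 𝒰_l and ℱ_l. … In each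
sector D_a, new variables z = (z_1,⋯,z_{N−1}) are introduced and t_j = t_j(z) is expressed as a monomial of z, and Jacobian J_a(z) is a monomial
of z with constant coefficient. … Integration domain of z is the (N−1)-dimensional unit cube (0 ≤ z_j ≤ 1). Polynomials 𝒰_l and ℱ_l are
expressed in the following form in each sector D_a: 𝒰_l = C_a z^{b_a}(1 + H_a(z)), ℱ_l = C_a' z^{b_a'}(1 + H_a'(z)), where b_a and b_a' are
(N−1)-tuples of non-negative integers …, H_a(z) and H_a'(z) are polynomials of z such that H_a(0) = 0 and H_a'(0) = 0." §3 [p6:L50–L66]: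
"The dominant term of P(t) in this limit is the monomial a_b t^b whose value of (b, u) takes the minimum value of (c,u) among all c ∈ Z^P:
(b, u) = min{(c, u) | c ∈ Z^P}. In other words, a monomial for a vector b is dominant in the domain Δ_b^P of y space, which is defined by:
Δ_b^P := {y ∈ ℝ^{N−1}_{≥0} | (b, y) ≤ (c, y), ∀c ∈ Z^P}. … P(t(y)) = Σ_{b∈Z^P} θ(y ∈ Δ_b^P) e^{−(b,y)}[a_b + Σ_{c∈Z^P∖{b}} a_c e^{−(c−b,y)}].
Since (c−b, y) ≥ 0 for y ∈ Δ_b^P, the behavior of P in the limit of ‖y‖ → ∞ is determined by the term a_b e^{−(b,y)}." §3, eq. (geo:glz) and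
after [p7:L63–L110]: "We subsequently change the variable from y to u then from u to z, where z_j = e^{−u_j}. Jacobian is |det V|/Π_j z_j. We
finally obtain: G_l = Σ_b Σ_{b'} Σ_{V∈S_{bb'}} |det V| ∫_0^1 d^{N−1}z Π_j z_j^{(ν' + γb + βb', v_j)−1} × [1 + Σ_{c∈Z^{𝒰_l}∖{b}} Π_j z_j^{(c−b, v_j)}]^γ
[a_{b'} + Σ_{c∈Z^{ℱ_l}∖{b'}} a_c Π_j z_j^{(c−b', v_j)}]^β. The original variables are expressed by: t_j = e^{−y_j} = e^{−(Vu)_j} = Π_k z_k^{(v_k)_j},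
with Jacobian |det V| Π_j t_j/Π_k z_k. … we can take vectors {v_j} on the integer lattice v_j ∈ ℤ^{N−1}_{≥0}∖{0}. Since (c−b, y) ≥ 0 for all
y ∈ Δ_b^P and (c−b) ∈ ℤ^{N−1}, (c−b, v_j) is non-negative integer. Thus the sub-expressions in the brackets of Eq. (geo:glz) are polynomials
of z."

TYPING. `N` original variables `t : Fin N → ℝ` (exponent vectors `c : Fin N →₀ ℕ` = `MvPolynomial` supports), `M` cone generators
`v : Fin M → (Fin N → ℕ)` on the integer lattice (the paper's square case is `M = N − 1` after the primary sector; nothing below needs `M = N−1`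
or linear independence — those enter only the Jacobian `|det V|`, which is not typed here), new variables `z : Fin M → ℝ`. The chart is
`coneChart v z j = Π_k z_k^{v k j}` ("t_j = Π_k z_k^{(v_k)_j}"), the pairing `ipair (v k) c = Σ_j (v k)_j c_j = (c, v_k) ∈ ℕ`, the cone-wise
valuation `minPair P (v k) = min_{c∈supp P} (c, v_k)` ("(b,u) = min{(c,u)}" evaluated at the generator `u = v_k`), and "b is dominant on the
cone spanned by the v_k" is the hypothesis `∀ k, ∀ c ∈ supp F, (b, v_k) ≤ (c, v_k)` (y ∈ Δ_b^P for every generator y = v_k, hence for the whole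
cone by linearity). Real coefficients; `Σ_c |p_c|` is the companion's `Borinsky2020.sumAbsCoeff` and `t^c` its `monom` (Theorem 8a's objects —
the file imports `Borinsky2020.TropicalApproximation` for them only). NO new named notion beyond the three local abbreviations `coneChart`,
`ipair`, `minPair` (definitions with bodies and unfolding lemmas).

PROVED (0 named facts, D-0026):
* `monom_coneChart` — "t^c = Π_k z_k^{(c, v_k)}" under the chart (the exponent bookkeeping of eq. (geo:glz));
* `eval_coneChart_eq_monom_mul` — **the printed normal form** on a dominant cone: `P(t(z)) = z^{(b,v)} · [p_b + Σ_{c≠b} p_c Π_k z_k^{(c,v_k)−(b,v_k)}]`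
  with natural-number exponents `(c,v_k) − (b,v_k)` ("(c−b, v_j) is non-negative integer … the sub-expressions in the brackets … are polynomials
  of z"); `coeff_le_bracket` / `bracket_le_sum_coeff` — for non-negative coefficients the bracket lies in `[p_b, Σ_c p_c]` on the closed cube
  `0 ≤ z ≤ 1` (the "(1 + H_a(z))" factor with `H_a ≥ 0`, `H_a(0) = 0`);
* `abs_eval_coneChart_le` — for ANY `P` (signed coefficients) and `0 ≤ z ≤ 1`: `|P(t(z))| ≤ (Σ_c |p_c|) · Π_k z_k^{min_c (c, v_k)}` (no
  domination needed: every monomial carries at least the minimal exponent in each `z_k`);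
* `coeff_mul_prod_pow_le_eval_coneChart` — for non-negative coefficients and ANY `b ∈ supp F`, `z ≥ 0`: `p_b · Π_k z_k^{(b, v_k)} ≤ F(t(z))`;
* **`abs_eval_div_prod_pow_le`** — the quotient: `|P(t(z))| / Π_k F_k(t(z))^{a_k} ≤ (Σ|p_c| / Π_k (f_{k,b_k})^{a_k}) · Π_l z_l^{minPair P (v l)} /
  Π_l z_l^{Σ_k a_k (b_k, v_l)}` on `(0,1]^M`, for any chosen support monomials `b_k` of the `F_k` (sharpest = the dominant ones, for which
  `(b_k, v_l) = min_c (c, v_l)`, `ipair_eq_minPair_of_dominant`);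
* **`abs_eval_div_prod_pow_mul_monom_le`** — BOUNDED SUMMAND WITH A STATED BOUND: if the extra monomial weight `w` (measure/Jacobian exponents)
  satisfies `Σ_k a_k (b_k, v_l) ≤ minPair P (v l) + w_l` for every `l` (BND: "E_l ≥ 0"), then
  `|P(t(z))| / Π_k F_k(t(z))^{a_k} · Π_l z_l^{w_l} ≤ Σ|p_c| / Π_k (f_{k,b_k})^{a_k}` on `(0,1]^M`.
NOT typed: the fan construction (dual cones, triangulation, §4), the Jacobian `|det V|` and the change of variables in the INTEGRAL (the cone
integral is `Borinsky2020.ConeIntegral` / `GeometricSectorDecomposition`), continuity/extension statements at `z_k = 0` (the inequalities are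
stated on `(0,1]^M` resp. `[0,1]^M` pointwise, which is what a per-point certificate uses), anything per graph.
-/

noncomputable section

open MvPolynomial Finset Real

namespace Literature.MathematicalPhysics.QuantumFieldTheory.KanekoUeda2010

open Borinsky2020

variable {N M : ℕ}

/-! ### The monomial chart of a cone and its exponent bookkeeping -/

/-- The cone chart "t_j = e^{−(Vu)_j} = Π_k z_k^{(v_k)_j}" of the simplicial cone spanned by lattice vectors `v_k ∈ ℤ^{N}_{≥0}`.
[cite: KanekoUeda2010, §3 after eq. (geo:glz) (chunk p7:L95–L99)] -/
def coneChart (v : Fin M → Fin N → ℕ) (z : Fin M → ℝ) : Fin N → ℝ := fun j => ∏ k, z k ^ v k j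

/-- The pairing "(c, v_k) = Σ_j c_j (v_k)_j" of an exponent vector with a cone generator (a natural number).
[cite: KanekoUeda2010, §3 (chunk p6:L50–L56, p7:L100–L104)] -/
def ipair (w : Fin N → ℕ) (c : Fin N →₀ ℕ) : ℕ := ∑ j ∈ c.support, w j * c j

/-- The cone-wise valuation "(b, u) = min{(c, u) | c ∈ Z^P}" at a generator `u = v_k` (junk `0` for `P = 0`).
[cite: KanekoUeda2010, §3 eq. before (geo:dom) (chunk p6:L50–L56)] -/
def minPair (p : MvPolynomial (Fin N) ℝ) (w : Fin N → ℕ) : ℕ :=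
  if h : p.support.Nonempty then p.support.inf' h (ipair w) else 0

/-- Unfolding of the chart. [cite: KanekoUeda2010, §3 (chunk p7:L95–L99)] -/
theorem coneChart_apply (v : Fin M → Fin N → ℕ) (z : Fin M → ℝ) (j : Fin N) : coneChart v z j = ∏ k, z k ^ v k j := rfl

/-- The chart maps the closed cube into the closed orthant. [cite: KanekoUeda2010, §2 (chunk p4:L145–L146: "0 ≤ z_j ≤ 1")] -/
theorem coneChart_nonneg (v : Fin M → Fin N → ℕ) {z : Fin M → ℝ} (hz : ∀ k, 0 ≤ z k) (j : Fin N) : 0 ≤ coneChart v z j :=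
  Finset.prod_nonneg fun k _ => pow_nonneg (hz k) _

/-- The chart maps the open cube into the open orthant. [cite: KanekoUeda2010, §3 (chunk p7:L95–L99)] -/
theorem coneChart_pos (v : Fin M → Fin N → ℕ) {z : Fin M → ℝ} (hz : ∀ k, 0 < z k) (j : Fin N) : 0 < coneChart v z j :=
  Finset.prod_pos fun k _ => pow_pos (hz k) _

/-- **Exponent bookkeeping of eq. (geo:glz)**: under the chart, the monomial `t^c` becomes `Π_k z_k^{(c, v_k)}`.
[cite: KanekoUeda2010, §3 eq. (geo:glz) (chunk p7:L63–L104)] -/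
theorem monom_coneChart (v : Fin M → Fin N → ℕ) (z : Fin M → ℝ) (c : Fin N →₀ ℕ) :
    monom c (coneChart v z) = ∏ k, z k ^ ipair (v k) c := by
  unfold monom coneChart ipair
  calc ∏ j ∈ c.support, (∏ k, z k ^ v k j) ^ c j
      = ∏ j ∈ c.support, ∏ k, z k ^ (v k j * c j) := by
        refine Finset.prod_congr rfl fun j _ => ?_
        rw [← Finset.prod_pow]
        exact Finset.prod_congr rfl fun k _ => (pow_mul _ _ _).symm
    _ = ∏ k, ∏ j ∈ c.support, z k ^ (v k j * c j) := Finset.prod_comm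
    _ = ∏ k, z k ^ ∑ j ∈ c.support, v k j * c j :=
        Finset.prod_congr rfl fun k _ => Finset.prod_pow_eq_pow_sum _ _ _

/-- `min_c (c, v_k) ≤ (c, v_k)` for every `c` of the support. [cite: KanekoUeda2010, §3 (chunk p6:L50–L56)] -/
theorem minPair_le {p : MvPolynomial (Fin N) ℝ} {w : Fin N → ℕ} {c : Fin N →₀ ℕ} (hc : c ∈ p.support) :
    minPair p w ≤ ipair w c := by
  have h : p.support.Nonempty := ⟨c, hc⟩
  simp only [minPair, h, ↓reduceDIte]
  exact Finset.inf'_le _ hc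

/-- The minimum is attained ("the monomial a_b t^b whose value of (b, u) takes the minimum value"). [cite: KanekoUeda2010, §3 (chunk p6:L50–L56)] -/
theorem exists_ipair_eq_minPair {p : MvPolynomial (Fin N) ℝ} (hp : p ≠ 0) (w : Fin N → ℕ) :
    ∃ c ∈ p.support, ipair w c = minPair p w := by
  have h : p.support.Nonempty := support_nonempty.mpr hp
  obtain ⟨c, hc, hmin⟩ := Finset.exists_mem_eq_inf' h (ipair w)
  exact ⟨c, hc, by simp only [minPair, h, ↓reduceDIte, hmin]⟩

/-- On a cone where `b` is DOMINANT ("(b, y) ≤ (c, y) ∀c ∈ Z^P" at every generator `y = v_k`), the valuation at each generator is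
`(b, v_k)`. [cite: KanekoUeda2010, §3 eq. (geo:dom) (chunk p6:L57–L66)] -/
theorem ipair_eq_minPair_of_dominant {p : MvPolynomial (Fin N) ℝ} {b : Fin N →₀ ℕ} (hb : b ∈ p.support) {w : Fin N → ℕ}
    (hdom : ∀ c ∈ p.support, ipair w b ≤ ipair w c) : ipair w b = minPair p w := by
  refine le_antisymm ?_ (minPair_le hb)
  have h : p.support.Nonempty := ⟨b, hb⟩
  simp only [minPair, h, ↓reduceDIte]
  exact (Finset.le_inf'_iff h _).2 hdom

/-! ### The printed normal form on a dominant cone, and the bracket's two-sided bound -/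

/-- **Eq. (geo:glz), the normal form of ONE polynomial on a dominant simplicial cone**: if `b ∈ supp P` is dominant at every generator
(`(b, v_k) ≤ (c, v_k)` for all `c ∈ supp P` and all `k`), then under the chart `t = t(z)`:
`P(t(z)) = (Π_k z_k^{(b, v_k)}) · [p_b + Σ_{c ∈ supp P ∖ {b}} p_c · Π_k z_k^{(c, v_k) − (b, v_k)}]`, all exponents `(c, v_k) − (b, v_k)` being
natural numbers ("(c−b, v_j) is non-negative integer. Thus the sub-expressions in the brackets of Eq. (geo:glz) are polynomials of z").
[cite: KanekoUeda2010, §3 eq. (geo:glz) and the paragraph after it (chunk p7:L63–L110)] -/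
theorem eval_coneChart_eq_monom_mul (p : MvPolynomial (Fin N) ℝ) {b : Fin N →₀ ℕ} (hb : b ∈ p.support)
    (v : Fin M → Fin N → ℕ) (hdom : ∀ k, ∀ c ∈ p.support, ipair (v k) b ≤ ipair (v k) c) (z : Fin M → ℝ) :
    eval (coneChart v z) p =
      (∏ k, z k ^ ipair (v k) b) *
        (p.coeff b + ∑ c ∈ p.support.erase b, p.coeff c * ∏ k, z k ^ (ipair (v k) c - ipair (v k) b)) := by
  classical
  rw [eval_eq_sum_coeff_mul_monom, ← Finset.add_sum_erase _ _ hb, mul_add, monom_coneChart, mul_comm (∏ k, z k ^ ipair (v k) b),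
    Finset.mul_sum]
  congr 1
  refine Finset.sum_congr rfl fun c hc => ?_
  have hc' : c ∈ p.support := Finset.mem_of_mem_erase hc
  rw [monom_coneChart, mul_left_comm, ← Finset.prod_mul_distrib]
  congr 1
  exact Finset.prod_congr rfl fun k _ => by rw [← pow_add, Nat.add_sub_cancel' (hdom k c hc')]

/-- Lower bound of the bracket for NON-NEGATIVE coefficients on `z ≥ 0`: `p_b ≤ p_b + Σ_{c≠b} p_c Π_k z_k^{(c,v_k)−(b,v_k)}` (the printed
"1 + H_a(z)" with `H_a ≥ 0`). [cite: KanekoUeda2010, §2 (chunk p4:L152–L176: "𝒰_l = C_a z^{b_a}(1 + H_a(z)) … H_a(0) = 0"); §3 eq. (geo:glz)] -/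
theorem coeff_le_bracket (p : MvPolynomial (Fin N) ℝ) (hpos : ∀ c ∈ p.support, 0 ≤ p.coeff c) (b : Fin N →₀ ℕ)
    (v : Fin M → Fin N → ℕ) {z : Fin M → ℝ} (hz : ∀ k, 0 ≤ z k) :
    p.coeff b ≤ p.coeff b + ∑ c ∈ p.support.erase b, p.coeff c * ∏ k, z k ^ (ipair (v k) c - ipair (v k) b) :=
  le_add_of_nonneg_right (Finset.sum_nonneg fun c hc =>
    mul_nonneg (hpos c (Finset.mem_of_mem_erase hc)) (Finset.prod_nonneg fun k _ => pow_nonneg (hz k) _))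

/-- Upper bound of the bracket for NON-NEGATIVE coefficients on the CLOSED cube `0 ≤ z ≤ 1`: `p_b + Σ_{c≠b} p_c Π_k z_k^{…} ≤ Σ_{c ∈ supp} p_c`
(= `P(1,…,1)`). [cite: KanekoUeda2010, §2 (chunk p4:L145–L176: "Integration domain of z is the (N−1)-dimensional unit cube (0 ≤ z_j ≤ 1)" and the form C_a z^{b_a}(1 + H_a(z))); §3 eq. (geo:glz)] -/
theorem bracket_le_sum_coeff (p : MvPolynomial (Fin N) ℝ) (hpos : ∀ c ∈ p.support, 0 ≤ p.coeff c) {b : Fin N →₀ ℕ} (hb : b ∈ p.support)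
    (v : Fin M → Fin N → ℕ) {z : Fin M → ℝ} (hz0 : ∀ k, 0 ≤ z k) (hz1 : ∀ k, z k ≤ 1) :
    p.coeff b + ∑ c ∈ p.support.erase b, p.coeff c * ∏ k, z k ^ (ipair (v k) c - ipair (v k) b) ≤ ∑ c ∈ p.support, p.coeff c := by
  rw [← Finset.add_sum_erase _ _ hb]
  refine add_le_add le_rfl (Finset.sum_le_sum fun c hc => ?_)
  have hc' : c ∈ p.support := Finset.mem_of_mem_erase hc
  calc p.coeff c * ∏ k, z k ^ (ipair (v k) c - ipair (v k) b) ≤ p.coeff c * 1 :=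
        mul_le_mul_of_nonneg_left (Finset.prod_le_one (fun k _ => pow_nonneg (hz0 k) _) fun k _ => pow_le_one₀ (hz0 k) (hz1 k))
          (hpos c hc')
    _ = p.coeff c := mul_one _

/-! ### The two one-sided bounds that a per-point certificate uses -/

/-- **Upper bound for ANY polynomial (signed coefficients) on the closed cube**: `|P(t(z))| ≤ (Σ_c |p_c|) · Π_k z_k^{min_c (c, v_k)}` for
`0 ≤ z ≤ 1` — every monomial `t^c = Π_k z_k^{(c,v_k)}` carries at least the minimal exponent in each `z_k`, and `z_k ≤ 1`. No domination is
needed for this direction. [cite: KanekoUeda2010, §3 eq. (geo:glz) and "(b, u) = min{(c, u) | c ∈ Z^P}" (chunk p6:L50–L56, p7:L63–L104)] -/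
theorem abs_eval_coneChart_le (p : MvPolynomial (Fin N) ℝ) (v : Fin M → Fin N → ℕ) {z : Fin M → ℝ}
    (hz0 : ∀ k, 0 ≤ z k) (hz1 : ∀ k, z k ≤ 1) :
    |eval (coneChart v z) p| ≤ sumAbsCoeff p * ∏ k, z k ^ minPair p (v k) := by
  rw [eval_eq_sum_coeff_mul_monom, sumAbsCoeff, Finset.sum_mul]
  refine (Finset.abs_sum_le_sum_abs _ _).trans (Finset.sum_le_sum fun c hc => ?_)
  rw [abs_mul, monom_coneChart, abs_of_nonneg (Finset.prod_nonneg fun k _ => pow_nonneg (hz0 k) _)]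
  refine mul_le_mul_of_nonneg_left ?_ (abs_nonneg _)
  exact Finset.prod_le_prod (fun k _ => pow_nonneg (hz0 k) _) fun k _ => pow_le_pow_of_le_one (hz0 k) (hz1 k) (minPair_le hc)

/-- **Lower bound for a positive-coefficient polynomial**: for ANY `b ∈ supp F` and `z ≥ 0`, `f_b · Π_k z_k^{(b, v_k)} ≤ F(t(z))` (drop the other,
non-negative, terms; with `b` dominant this is "the behavior of P … is determined by the term a_b e^{−(b,y)}" as an inequality).
[cite: KanekoUeda2010, §3 (chunk p6:L57–L70); §2 (chunk p4:L152–L176)] -/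
theorem coeff_mul_prod_pow_le_eval_coneChart (F : MvPolynomial (Fin N) ℝ) (hpos : ∀ c ∈ F.support, 0 ≤ F.coeff c)
    {b : Fin N →₀ ℕ} (hb : b ∈ F.support) (v : Fin M → Fin N → ℕ) {z : Fin M → ℝ} (hz : ∀ k, 0 ≤ z k) :
    F.coeff b * ∏ k, z k ^ ipair (v k) b ≤ eval (coneChart v z) F := by
  rw [eval_eq_sum_coeff_mul_monom, ← monom_coneChart]
  exact Finset.single_le_sum (f := fun c => F.coeff c * monom c (coneChart v z))
    (fun c hc => mul_nonneg (hpos c hc) (Finset.prod_nonneg fun j _ => pow_nonneg (coneChart_nonneg v hz j) _)) hb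

/-! ### The quotient `P / Π_k F_k^{a_k}`: bounded summand with a stated bound -/

section Quotient

variable {K : Type*} [Fintype K]

/-- Rearrangement of the product of the denominators' lower bounds: `Π_k (f_k · Π_l z_l^{e_{kl}})^{a_k} = (Π_k f_k^{a_k}) · Π_l z_l^{Σ_k a_k e_{kl}}`.
Plumbing. [cite: KanekoUeda2010, §3 eq. (geo:glz) (chunk p7:L63–L80: the exponent (ν' + γb + βb', v_j) collects the powers)] -/
theorem prod_mul_prod_pow_pow (f : K → ℝ) (e : K → Fin M → ℕ) (a : K → ℕ) (z : Fin M → ℝ) :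
    ∏ k, (f k * ∏ l, z l ^ e k l) ^ a k = (∏ k, f k ^ a k) * ∏ l, z l ^ ∑ k, a k * e k l := by
  simp_rw [mul_pow, Finset.prod_mul_distrib]
  congr 1
  calc ∏ k, (∏ l, z l ^ e k l) ^ a k = ∏ k, ∏ l, z l ^ (a k * e k l) := by
        refine Finset.prod_congr rfl fun k _ => ?_
        rw [← Finset.prod_pow]
        exact Finset.prod_congr rfl fun l _ => by rw [← pow_mul, mul_comm]
    _ = ∏ l, ∏ k, z l ^ (a k * e k l) := Finset.prod_comm
    _ = ∏ l, z l ^ ∑ k, a k * e k l := Finset.prod_congr rfl fun l _ => Finset.prod_pow_eq_pow_sum _ _ _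

/-- **The quotient on a cone, pointwise on `(0,1]^M`.** `P` any polynomial; `F_k` with non-negative coefficients and a chosen support monomial
`b_k` with `f_{k,b_k} > 0` (in the application: the DOMINANT monomial on the cone, `ipair_eq_minPair_of_dominant`); natural powers `a_k`. Then
`|P(t(z))| / Π_k F_k(t(z))^{a_k} ≤ (Σ_c|p_c| / Π_k f_{k,b_k}^{a_k}) · (Π_l z_l^{min_c (c,v_l)}) / Π_l z_l^{Σ_k a_k (b_k, v_l)}`.
[cite: KanekoUeda2010, §3 eq. (geo:glz) (chunk p7:L63–L110); §2 eq. after (chunk p4:L178–L190: G_l = Σ_a C_a'^β C_a^γ ∫ z^{c_a + b_a'β + b_aγ} (1+H_a)^γ (1+H_a')^β)] -/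
theorem abs_eval_div_prod_pow_le (P : MvPolynomial (Fin N) ℝ) (F : K → MvPolynomial (Fin N) ℝ) (a : K → ℕ)
    (hFpos : ∀ k, ∀ c ∈ (F k).support, 0 ≤ (F k).coeff c)
    (b : K → (Fin N →₀ ℕ)) (hb : ∀ k, b k ∈ (F k).support) (hc : ∀ k, 0 < (F k).coeff (b k))
    (v : Fin M → Fin N → ℕ) {z : Fin M → ℝ} (hz0 : ∀ l, 0 < z l) (hz1 : ∀ l, z l ≤ 1) :
    |eval (coneChart v z) P| / ∏ k, eval (coneChart v z) (F k) ^ a k ≤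
      sumAbsCoeff P / (∏ k, (F k).coeff (b k) ^ a k) *
        ((∏ l, z l ^ minPair P (v l)) / ∏ l, z l ^ ∑ k, a k * ipair (v l) (b k)) := by
  have hz0' : ∀ l, 0 ≤ z l := fun l => (hz0 l).le
  -- the denominator dominates its monomial minorant, which is positive
  set D₀ : ℝ := ∏ k, ((F k).coeff (b k) * ∏ l, z l ^ ipair (v l) (b k)) ^ a k with hD₀
  have hD₀pos : 0 < D₀ := Finset.prod_pos fun k _ => pow_pos (mul_pos (hc k) (Finset.prod_pos fun l _ => pow_pos (hz0 l) _)) _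
  have hD₀le : D₀ ≤ ∏ k, eval (coneChart v z) (F k) ^ a k :=
    Finset.prod_le_prod (fun k _ => pow_nonneg (mul_nonneg (hc k).le (Finset.prod_nonneg fun l _ => pow_nonneg (hz0' l) _)) _)
      fun k _ => pow_le_pow_left₀ (mul_nonneg (hc k).le (Finset.prod_nonneg fun l _ => pow_nonneg (hz0' l) _))
        (coeff_mul_prod_pow_le_eval_coneChart (F k) (hFpos k) (hb k) v hz0') _
  have hD₀eq : D₀ = (∏ k, (F k).coeff (b k) ^ a k) * ∏ l, z l ^ ∑ k, a k * ipair (v l) (b k) :=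
    prod_mul_prod_pow_pow (fun k => (F k).coeff (b k)) (fun k l => ipair (v l) (b k)) a z
  have hCpos : 0 < ∏ k, (F k).coeff (b k) ^ a k := Finset.prod_pos fun k _ => pow_pos (hc k) _
  have hZpos : 0 < ∏ l, z l ^ ∑ k, a k * ipair (v l) (b k) := Finset.prod_pos fun l _ => pow_pos (hz0 l) _
  calc |eval (coneChart v z) P| / ∏ k, eval (coneChart v z) (F k) ^ a k
      ≤ |eval (coneChart v z) P| / D₀ := div_le_div_of_nonneg_left (abs_nonneg _) hD₀pos hD₀le
    _ ≤ (sumAbsCoeff P * ∏ l, z l ^ minPair P (v l)) / D₀ :=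
        div_le_div_of_nonneg_right (abs_eval_coneChart_le P v hz0' hz1) hD₀pos.le
    _ = sumAbsCoeff P / (∏ k, (F k).coeff (b k) ^ a k) *
          ((∏ l, z l ^ minPair P (v l)) / ∏ l, z l ^ ∑ k, a k * ipair (v l) (b k)) := by
        rw [hD₀eq, mul_div_mul_comm]

/-- **BOUNDED SUMMAND WITH A STATED BOUND (qed-hepp BOUNDEDNESS.md 5.8.1 / README §1's "B bounded on the closed cube with a stated bound").**
In the setting of `abs_eval_div_prod_pow_le`, let `w : Fin M → ℕ` be an extra monomial weight (the exponents of the measure `t^{ν'−1}` and of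
the Jacobian `|det V| Π t_j/Π z_k` in eq. (geo:glz), or of a sampling density). If at every generator the total exponent is non-negative —
`Σ_k a_k (b_k, v_l) ≤ min_c (c, v_l) + w_l` for all `l` (BND: `E_l ≥ 0`) — then on `(0,1]^M`
`|P(t(z))| / Π_k F_k(t(z))^{a_k} · Π_l z_l^{w_l} ≤ Σ_c|p_c| / Π_k f_{k,b_k}^{a_k}` — a constant read off the coefficients.
[cite: KanekoUeda2010, §3 eq. (geo:glz) (chunk p7:L63–L110); §2 (chunk p4:L120–L190: "factoring out the possible singularities at t_j = 0")] -/
theorem abs_eval_div_prod_pow_mul_monom_le (P : MvPolynomial (Fin N) ℝ) (F : K → MvPolynomial (Fin N) ℝ) (a : K → ℕ)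
    (hFpos : ∀ k, ∀ c ∈ (F k).support, 0 ≤ (F k).coeff c)
    (b : K → (Fin N →₀ ℕ)) (hb : ∀ k, b k ∈ (F k).support) (hc : ∀ k, 0 < (F k).coeff (b k))
    (v : Fin M → Fin N → ℕ) (w : Fin M → ℕ) (hE : ∀ l, ∑ k, a k * ipair (v l) (b k) ≤ minPair P (v l) + w l)
    {z : Fin M → ℝ} (hz0 : ∀ l, 0 < z l) (hz1 : ∀ l, z l ≤ 1) :
    |eval (coneChart v z) P| / (∏ k, eval (coneChart v z) (F k) ^ a k) * ∏ l, z l ^ w l ≤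
      sumAbsCoeff P / ∏ k, (F k).coeff (b k) ^ a k := by
  have hz0' : ∀ l, 0 ≤ z l := fun l => (hz0 l).le
  have h1 := abs_eval_div_prod_pow_le P F a hFpos b hb hc v hz0 hz1
  have hZpos : 0 < ∏ l, z l ^ ∑ k, a k * ipair (v l) (b k) := Finset.prod_pos fun l _ => pow_pos (hz0 l) _
  have hconst : 0 ≤ sumAbsCoeff P / ∏ k, (F k).coeff (b k) ^ a k :=
    div_nonneg (Finset.sum_nonneg fun _ _ => abs_nonneg _) (Finset.prod_nonneg fun k _ => pow_nonneg (hc k).le _)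
  -- the monomial ratio is at most one: exponent-wise `S_l ≤ m_l + w_l` and `z_l ≤ 1`
  have hratio : (∏ l, z l ^ minPair P (v l)) / (∏ l, z l ^ ∑ k, a k * ipair (v l) (b k)) * ∏ l, z l ^ w l ≤ 1 := by
    rw [div_mul_eq_mul_div, ← Finset.prod_mul_distrib, div_le_one hZpos]
    refine Finset.prod_le_prod (fun l _ => mul_nonneg (pow_nonneg (hz0' l) _) (pow_nonneg (hz0' l) _)) fun l _ => ?_
    rw [← pow_add]
    exact pow_le_pow_of_le_one (hz0' l) (hz1 l) (hE l)
  calc |eval (coneChart v z) P| / (∏ k, eval (coneChart v z) (F k) ^ a k) * ∏ l, z l ^ w l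
      ≤ sumAbsCoeff P / (∏ k, (F k).coeff (b k) ^ a k) *
          ((∏ l, z l ^ minPair P (v l)) / ∏ l, z l ^ ∑ k, a k * ipair (v l) (b k)) * ∏ l, z l ^ w l :=
        mul_le_mul_of_nonneg_right h1 (Finset.prod_nonneg fun l _ => pow_nonneg (hz0' l) _)
    _ = sumAbsCoeff P / (∏ k, (F k).coeff (b k) ^ a k) *
          (((∏ l, z l ^ minPair P (v l)) / ∏ l, z l ^ ∑ k, a k * ipair (v l) (b k)) * ∏ l, z l ^ w l) := by ring
    _ ≤ sumAbsCoeff P / (∏ k, (F k).coeff (b k) ^ a k) * 1 := mul_le_mul_of_nonneg_left hratio hconst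
    _ = sumAbsCoeff P / ∏ k, (F k).coeff (b k) ^ a k := mul_one _

end Quotient

end Literature.MathematicalPhysics.QuantumFieldTheory.KanekoUeda2010
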